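import Mathlib
import Summits.MatrixMultiplication.MatrixMultiplication.Theses.GLnSeparatingDesigns

/-!
# `GLnSeparatingDesigns.BorderHalfDimensionDesigns` (stmt-MatrixMultiplication-18360) — Negative lane, I:
# the counting engine, the redundancy of the TPP conjunct, the two-set packing bound

Negative / support lemmas of the standing disprover (`Cruxes/BorderHalfDimensionDesigns/Disproof.lean`,
§(a), §(b)), landed for import by ideators, planners and the line lead.  No Theses statement is asserted
positively here; the TPP clause, the separator clause and `pt` (entries of `x y⁻¹ y' z⁻¹`) are written
exactly as in the crux (`∀ε>0 ∃n≥3 ∀δ>0 ∀q₀ ∃q≥q₀ ∀η>0 ∃X Y Z, TPP ∧ sizes ≥ q^(n²/2−εn) ∧ separators of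
degree ≤ q^(1+δ)`; the Disproof file checks the match by `Iff.rfl`).

* `tpp_of_separators` — at tolerance `η < 1/2` the separator clause forces the TPP clause: the TPP
  conjunct of the crux is not load-bearing.
* `card_le_finrank_of_approx_dual` — engine: an `η`-approximate dual family of functions in a subspace
  `W` with `η·#ι < 1` forces `#ι ≤ dim W` (strict diagonal dominance, `det_ne_zero_of_sum_row_lt_diag`).
* `card_mul_card_le_of_separators` — `|X|·|Z| ≤ (s+1)^(n²)` for every design with `η|X||Z| < 1`
  (no TPP, no `ω`); `no_designs_beyond_counting` — exponent form: size exponent `a` per set and degree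
  exponent `b ≥ 0` need `2a ≤ b·n²`.
Sequels: `CountingStrengthenings` (the two natural strengthenings of the crux are false),
`AffineSubfamilyBounds` / `AffineSubfamilyKills` (design sets cannot live in affine subspaces of
dimension `≤ (n²−n)/2`).
-/

namespace Summit.MatrixMultiplication.MatrixMultiplication.Theorems

open scoped BigOperators Matrix
open Finset

namespace BorderHalfDimensionDesignsNeg

/-! ## Engine: an approximate dual family forces `card ≤ finrank` -/

/-- **Approximate-duality rank lemma.** If functions `f i : ι → ℂ` all lie in a subspace `W`
and form an `η`-approximate dual family (`f i i ≈ 1`, `f i j ≈ 0`) with `η · #ι < 1`, then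
`#ι ≤ dim W` (strict diagonal dominance ⇒ the matrix `(f i j)` is invertible). [folklore] -/
theorem card_le_finrank_of_approx_dual {ι : Type*} [Fintype ι] [DecidableEq ι]
    (W : Submodule ℂ (ι → ℂ)) (f : ι → ι → ℂ) (hf : ∀ i, f i ∈ W) (η : ℝ)
    (hη : η * Fintype.card ι < 1)
    (hdiag : ∀ i, ‖f i i - 1‖ ≤ η) (hoff : ∀ i j, i ≠ j → ‖f i j‖ ≤ η) :
    Fintype.card ι ≤ Module.finrank ℂ W := by
  set A : Matrix ι ι ℂ := Matrix.of fun i j => f i j with hA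
  have hdet : A.det ≠ 0 := by
    apply det_ne_zero_of_sum_row_lt_diag
    intro k
    -- g j := the deviation of entry (k,j) from the identity matrix
    set g : ι → ℝ := fun j => if j = k then ‖A k k - 1‖ else ‖A k j‖ with hg
    have hgle : ∀ j ∈ (univ : Finset ι), g j ≤ η := by
      intro j _
      by_cases hjk : j = k
      · subst hjk; simp only [g, if_true, A, Matrix.of_apply]; exact hdiag j
      · simp only [g, if_neg hjk, A, Matrix.of_apply]; exact hoff k j (Ne.symm hjk)
    have hsum : ∑ j, g j ≤ (Fintype.card ι : ℝ) * η := by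
      have := Finset.sum_le_card_nsmul (univ : Finset ι) g η hgle
      simpa [nsmul_eq_mul] using this
    have hsplit : ∑ j, g j = ‖A k k - 1‖ + ∑ j ∈ univ.erase k, ‖A k j‖ := by
      rw [← Finset.add_sum_erase _ _ (mem_univ k)]
      congr 1
      · simp [g]
      · refine Finset.sum_congr rfl fun j hj => ?_
        simp [g, Finset.ne_of_mem_erase hj]
    have htri : 1 - ‖A k k - 1‖ ≤ ‖A k k‖ := by
      have := norm_sub_norm_le (1 : ℂ) (1 - A k k)
      rw [norm_one, sub_sub_cancel, norm_sub_rev] at this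
      linarith
    have hη' : (Fintype.card ι : ℝ) * η < 1 := by rwa [mul_comm] at hη
    linarith
  have hunit : IsUnit A := (Matrix.isUnit_iff_isUnit_det A).2 (isUnit_iff_ne_zero.2 hdet)
  have hrank : A.rank = Fintype.card ι := Matrix.rank_of_isUnit A hunit
  rw [← hrank, Matrix.rank_eq_finrank_span_row]
  apply Submodule.finrank_mono
  rw [Submodule.span_le]
  rintro _ ⟨i, rfl⟩
  have : A.row i = f i := by funext j; rfl
  rw [this]
  exact hf i


/-! ## The crux's separator clause, named -/

/-- The sampled group element of a quadruple, as the crux types it: the `n²` entries of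
`x y⁻¹ y' z⁻¹` (notation, so that statements stay literally the crux's clauses). -/
scoped notation3 "pt " x:max y:max w:max z:max =>
  fun ij : Fin _ × Fin _ => (x * y⁻¹ * w * z⁻¹ : Matrix.GeneralLinearGroup (Fin _) ℂ).val ij.1 ij.2

/-! ## (a) Load-bearing analysis: the TPP conjunct is NOT load-bearing

For `η < 1/2` the separator clause alone implies the TPP clause: a coincidence
`x y⁻¹ y' z⁻¹ = x' z'⁻¹` with `(x, y, z) ≠ (x', y', z')` would put the separator of the target
`(x', z')` within `η` of both `0` and `1` at the same point.  So dropping the TPP conjunct from the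
crux gives an EQUIVALENT statement (`borderHalfDimensionDesigns_iff_withoutTPP` in the Disproof file); all the
content is in sizes + degree + approximate separation. -/

/-- Separators at tolerance `η < 1/2` force the triple product property. [folklore] -/
theorem tpp_of_separators {n s : ℕ} {X Y Z : Finset (Matrix.GeneralLinearGroup (Fin n) ℂ)} {η : ℝ} (hη : η < 1 / 2)
    (hsep : ∀ x₀ ∈ X, ∀ z₀ ∈ Z, ∃ p : MvPolynomial (Fin n × Fin n) ℂ, p.totalDegree ≤ s ∧
      ∀ x ∈ X, ∀ y ∈ Y, ∀ y' ∈ Y, ∀ z ∈ Z,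
        ((x = x₀ ∧ y = y' ∧ z = z₀) → ‖MvPolynomial.eval (pt x y y' z) p - 1‖ ≤ η) ∧
        (¬ (x = x₀ ∧ y = y' ∧ z = z₀) → ‖MvPolynomial.eval (pt x y y' z) p‖ ≤ η)) :
    ∀ x ∈ X, ∀ x' ∈ X, ∀ y ∈ Y, ∀ y' ∈ Y, ∀ z ∈ Z, ∀ z' ∈ Z,
      x * y⁻¹ * y' * z⁻¹ = x' * z'⁻¹ → x = x' ∧ y = y' ∧ z = z' := by
  intro x hx x' hx' y hy y' hy' z hz z' hz' h
  by_contra hne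
  obtain ⟨p, -, hp⟩ := hsep x' hx' z' hz'
  have h0 := (hp x hx y hy y' hy' z hz).2 hne
  have h1 := (hp x' hx' y hy y hy z' hz').1 ⟨rfl, rfl, rfl⟩
  have e : pt x y y' z = pt x' y y z' := by
    have e1 : x * y⁻¹ * y' * z⁻¹ = x' * y⁻¹ * y * z'⁻¹ := by rw [h]; group
    funext ij
    show ((x * y⁻¹ * y' * z⁻¹ : Matrix.GeneralLinearGroup (Fin n) ℂ) : Matrix (Fin n) (Fin n) ℂ) ij.1 ij.2 =
      ((x' * y⁻¹ * y * z'⁻¹ : Matrix.GeneralLinearGroup (Fin n) ℂ) : Matrix (Fin n) (Fin n) ℂ) ij.1 ij.2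
    rw [e1]
  rw [e] at h0
  have h2 : (1 : ℝ) ≤ ‖(1 : ℂ) - MvPolynomial.eval (pt x' y y z') p‖ +
      ‖MvPolynomial.eval (pt x' y y z') p‖ := by
    have := norm_sub_norm_le (1 : ℂ) ((1 : ℂ) - MvPolynomial.eval (pt x' y y z') p)
    rw [norm_one, sub_sub_cancel] at this
    linarith
  rw [norm_sub_rev] at h1
  linarith

/-! ## (b) Counting / tightness: `|X|·|Z| ≤ (s+1)^(n²)` — no TPP needed -/

/-- A coefficient of a monomial in the support is at most the total degree. [folklore] -/
theorem apply_le_totalDegree {σ : Type*} {p : MvPolynomial σ ℂ} {d : σ →₀ ℕ}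
    (hd : d ∈ p.support) (i : σ) : d i ≤ p.totalDegree := by
  refine le_trans ?_ (MvPolynomial.le_totalDegree hd)
  by_cases hi : i ∈ d.support
  · exact Finset.single_le_sum (f := fun a => d a) (fun _ _ => Nat.zero_le _) hi
  · rw [Finsupp.notMem_support_iff.mp hi]; exact Nat.zero_le _

/-- **Counting bound (two-set packing).** If `Y ≠ ∅` and every target `(x₀, z₀) ∈ X × Z` has an
`η`-approximate separator of total degree `≤ s` with `η·|X|·|Z| < 1`, then `|X|·|Z| ≤ (s+1)^(n²)`:
restricted to the `|X|·|Z|` points `x y₀⁻¹ y₀ z⁻¹` the separators form an approximate dual basis inside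
the span of the `≤ (s+1)^(n²)` monomial functions of exponents `≤ s`.  The TPP is not used. [folklore] -/
theorem card_mul_card_le_of_separators {n s : ℕ} {X Y Z : Finset (Matrix.GeneralLinearGroup (Fin n) ℂ)} {η : ℝ}
    (hY : Y.Nonempty) (hsep : ∀ x₀ ∈ X, ∀ z₀ ∈ Z, ∃ p : MvPolynomial (Fin n × Fin n) ℂ, p.totalDegree ≤ s ∧
      ∀ x ∈ X, ∀ y ∈ Y, ∀ y' ∈ Y, ∀ z ∈ Z,
        ((x = x₀ ∧ y = y' ∧ z = z₀) → ‖MvPolynomial.eval (pt x y y' z) p - 1‖ ≤ η) ∧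
        (¬ (x = x₀ ∧ y = y' ∧ z = z₀) → ‖MvPolynomial.eval (pt x y y' z) p‖ ≤ η))
    (hη : η * (X.card * Z.card) < 1) :
    X.card * Z.card ≤ (s + 1) ^ (n * n) := by
  classical
  obtain ⟨y₀, hy₀⟩ := hY
  choose p hpdeg hpsep using hsep
  -- points, separator values, monomial functions
  set P : ↥X × ↥Z → (Fin n × Fin n → ℂ) := fun j => pt j.1.1 y₀ y₀ j.2.1 with hP
  set f : ↥X × ↥Z → ↥X × ↥Z → ℂ :=
    fun i j => MvPolynomial.eval (P j) (p i.1.1 i.1.2 i.2.1 i.2.2) with hf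
  set mono : (Fin n × Fin n → Fin (s + 1)) → (↥X × ↥Z → ℂ) :=
    fun μ j => ∏ ij, (P j ij) ^ (μ ij : ℕ) with hmono
  set W : Submodule ℂ (↥X × ↥Z → ℂ) := Submodule.span ℂ (Set.range mono) with hW
  have hWle : Module.finrank ℂ W ≤ (s + 1) ^ (n * n) := by
    have h := finrank_range_le_card (R := ℂ) mono
    simpa [W, Set.finrank, Fintype.card_fun, Fintype.card_prod, Fintype.card_fin] using h
  have hfW : ∀ i, f i ∈ W := by
    intro i
    set Q := p i.1.1 i.1.2 i.2.1 i.2.2 with hQ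
    have hexp : f i = ∑ d ∈ Q.support, (MvPolynomial.coeff d Q) • (fun j => ∏ ij, P j ij ^ d ij) := by
      funext j
      simp only [f, Finset.sum_apply, Pi.smul_apply, smul_eq_mul]
      rw [MvPolynomial.eval_eq]
      refine Finset.sum_congr rfl fun d _ => ?_
      congr 1
      exact Finset.prod_subset (Finset.subset_univ _)
        (fun ij _ hij => by rw [Finsupp.notMem_support_iff.mp hij, pow_zero])
    rw [hexp]
    refine Submodule.sum_mem _ fun d hd => Submodule.smul_mem _ _ (Submodule.subset_span ?_)
    refine ⟨fun ij => ⟨d ij, Nat.lt_succ_of_le ((apply_le_totalDegree hd ij).trans (hpdeg _ _ _ _))⟩, ?_⟩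
    funext j
    simp [mono]
  have hcard : Fintype.card (↥X × ↥Z) = X.card * Z.card := by simp
  have key := card_le_finrank_of_approx_dual W f hfW η (by rw [hcard]; push_cast; exact hη)
    (fun i => (hpsep i.1.1 i.1.2 i.2.1 i.2.2 i.1.1 i.1.2 y₀ hy₀ y₀ hy₀ i.2.1 i.2.2).1 ⟨rfl, rfl, rfl⟩)
    (fun i j hij => (hpsep i.1.1 i.1.2 i.2.1 i.2.2 j.1.1 j.1.2 y₀ hy₀ y₀ hy₀ j.2.1 j.2.2).2
      (fun h => hij (Prod.ext (Subtype.ext h.1.symm) (Subtype.ext h.2.2.symm))))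
  rw [hcard] at key
  exact key.trans hWle


/-- **Counting barrier, exponent form.** For a fixed `n`, size exponent `a` and degree exponent
`b ≥ 0` with `b·n² < 2a`, there is NO family (over arbitrarily large `q`, every tolerance `η`) of
finite `X, Y, Z ⊆ GL_n(ℂ)` with `|X|, |Y|, |Z| ≥ q^a` and `η`-separators of degree `≤ q^b`:
`q^(2a) ≤ |X||Z| ≤ (q^b + 1)^(n²)` fails for large `q`.  (TPP not even assumed.) [folklore] -/
theorem no_designs_beyond_counting (n : ℕ) {a b : ℝ} (hb : 0 ≤ b) (hab : b * (n : ℝ) ^ 2 < 2 * a) :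
    ¬ (∀ q₀ : ℕ, ∃ q : ℕ, q₀ ≤ q ∧ ∀ η : ℝ, 0 < η → ∃ X Y Z : Finset (Matrix.GeneralLinearGroup (Fin n) ℂ),
        (q : ℝ) ^ a ≤ (X.card : ℝ) ∧ (q : ℝ) ^ a ≤ (Y.card : ℝ) ∧ (q : ℝ) ^ a ≤ (Z.card : ℝ) ∧
        ∀ x₀ ∈ X, ∀ z₀ ∈ Z, ∃ p : MvPolynomial (Fin n × Fin n) ℂ,
          (p.totalDegree : ℝ) ≤ (q : ℝ) ^ b ∧
          ∀ x ∈ X, ∀ y ∈ Y, ∀ y' ∈ Y, ∀ z ∈ Z,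
            ((x = x₀ ∧ y = y' ∧ z = z₀) → ‖MvPolynomial.eval (pt x y y' z) p - 1‖ ≤ η) ∧
            (¬ (x = x₀ ∧ y = y' ∧ z = z₀) → ‖MvPolynomial.eval (pt x y y' z) p‖ ≤ η)) := by
  intro H
  set γ : ℝ := 2 * a - b * (n : ℝ) ^ 2 with hγ
  have hγpos : 0 < γ := by rw [hγ]; linarith
  set B : ℝ := (2 : ℝ) ^ (((n : ℝ) ^ 2 + 1) / γ) with hB
  obtain ⟨q, hq₀, Hq⟩ := H (⌈B⌉₊ + 2)
  have hqB : B ≤ q := le_trans (Nat.le_ceil B) (by exact_mod_cast (by omega : ⌈B⌉₊ ≤ q))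
  have hq2 : (2 : ℝ) ≤ q := by exact_mod_cast (by omega : 2 ≤ q)
  have hq1 : (1 : ℝ) ≤ q := by linarith
  have hq0 : (0 : ℝ) < q := by linarith
  set N : ℕ := ⌈(q : ℝ) ^ a⌉₊ with hN
  set s : ℕ := ⌊(q : ℝ) ^ b⌋₊ with hs
  have hqa : (0 : ℝ) < (q : ℝ) ^ a := Real.rpow_pos_of_pos hq0 a
  have hqb1 : (1 : ℝ) ≤ (q : ℝ) ^ b := Real.one_le_rpow hq1 hb
  set η : ℝ := 1 / (2 * ((N : ℝ) * N + 1)) with hη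
  have hηpos : 0 < η := by rw [hη]; positivity
  obtain ⟨X, Y, Z, hX, hY, hZ, hsep⟩ := Hq η hηpos
  have hNX : N ≤ X.card := Nat.ceil_le.mpr hX
  have hNZ : N ≤ Z.card := Nat.ceil_le.mpr hZ
  have hYne : Y.Nonempty := by
    rw [← Finset.card_pos]
    have : (0 : ℝ) < Y.card := lt_of_lt_of_le hqa hY
    exact_mod_cast this
  obtain ⟨X', hX'X, hX'card⟩ := Finset.exists_subset_card_eq hNX
  obtain ⟨Z', hZ'Z, hZ'card⟩ := Finset.exists_subset_card_eq hNZ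
  have hsep' : ∀ x₀ ∈ X', ∀ z₀ ∈ Z', ∃ p : MvPolynomial (Fin n × Fin n) ℂ, p.totalDegree ≤ s ∧
      ∀ x ∈ X', ∀ y ∈ Y, ∀ y' ∈ Y, ∀ z ∈ Z',
        ((x = x₀ ∧ y = y' ∧ z = z₀) → ‖MvPolynomial.eval (pt x y y' z) p - 1‖ ≤ η) ∧
        (¬ (x = x₀ ∧ y = y' ∧ z = z₀) → ‖MvPolynomial.eval (pt x y y' z) p‖ ≤ η) := by
    intro x₀ hx₀ z₀ hz₀
    obtain ⟨p, hpdeg, hp⟩ := hsep x₀ (hX'X hx₀) z₀ (hZ'Z hz₀)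
    exact ⟨p, Nat.le_floor hpdeg,
      fun x hx y hy y' hy' z hz => hp x (hX'X hx) y hy y' hy' z (hZ'Z hz)⟩
  have hηN : η * (X'.card * Z'.card) < 1 := by
    rw [hX'card, hZ'card, hη]
    have hNN : (0 : ℝ) ≤ (N : ℝ) * N := by positivity
    rw [div_mul_eq_mul_div, one_mul, div_lt_one (by positivity)]
    linarith
  have hcount := card_mul_card_le_of_separators hYne hsep' hηN
  rw [hX'card, hZ'card] at hcount
  -- real-number bookkeeping: q^(2a) ≤ N² ≤ (s+1)^(n²) ≤ 2^(n²) q^(b n²)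
  have hcountR : ((q : ℝ) ^ a) ^ 2 ≤ ((s : ℝ) + 1) ^ (n * n) := by
    have h1 : ((q : ℝ) ^ a) ^ 2 ≤ (N : ℝ) ^ 2 := pow_le_pow_left₀ hqa.le (Nat.le_ceil _) 2
    have h2 : (N : ℝ) ^ 2 ≤ ((s : ℝ) + 1) ^ (n * n) := by
      rw [sq]; exact_mod_cast hcount
    exact h1.trans h2
  have hs1 : (s : ℝ) + 1 ≤ 2 * (q : ℝ) ^ b := by
    have : (s : ℝ) ≤ (q : ℝ) ^ b := Nat.floor_le (by positivity)
    linarith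
  have h3 : ((s : ℝ) + 1) ^ (n * n) ≤ (2 * (q : ℝ) ^ b) ^ (n * n) :=
    pow_le_pow_left₀ (by positivity) hs1 _
  have h4 : (2 * (q : ℝ) ^ b) ^ (n * n) = (2 : ℝ) ^ (n * n) * (q : ℝ) ^ (b * (n : ℝ) ^ 2) := by
    rw [mul_pow, ← Real.rpow_natCast ((q : ℝ) ^ b) (n * n), ← Real.rpow_mul hq0.le]
    push_cast
    congr 2
    ring
  have h5 : ((q : ℝ) ^ a) ^ 2 = (q : ℝ) ^ γ * (q : ℝ) ^ (b * (n : ℝ) ^ 2) := by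
    rw [← Real.rpow_natCast ((q : ℝ) ^ a) 2, ← Real.rpow_mul hq0.le, ← Real.rpow_add hq0]
    congr 1
    push_cast
    rw [hγ]; ring
  have h6 : (q : ℝ) ^ γ * (q : ℝ) ^ (b * (n : ℝ) ^ 2)
      ≤ (2 : ℝ) ^ (n * n) * (q : ℝ) ^ (b * (n : ℝ) ^ 2) := by
    rw [← h5, ← h4]; exact hcountR.trans h3
  have h7 : (q : ℝ) ^ γ ≤ (2 : ℝ) ^ (n * n) :=
    le_of_mul_le_mul_right h6 (Real.rpow_pos_of_pos hq0 _)
  -- while q ≥ B = 2^((n²+1)/γ) forces q^γ ≥ 2^(n²+1)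
  have h8 : B ^ γ ≤ (q : ℝ) ^ γ := Real.rpow_le_rpow (by positivity) hqB hγpos.le
  have h9 : B ^ γ = 2 * (2 : ℝ) ^ (n * n) := by
    rw [hB, ← Real.rpow_mul (by norm_num : (0 : ℝ) ≤ 2), div_mul_cancel₀ _ hγpos.ne',
      Real.rpow_add (by norm_num : (0 : ℝ) < 2), Real.rpow_one, mul_comm]
    congr 1
    rw [← Real.rpow_natCast (2 : ℝ) (n * n)]
    push_cast
    congr 1
    ring
  have h10 : (0 : ℝ) < (2 : ℝ) ^ (n * n) := by positivity
  linarith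

end BorderHalfDimensionDesignsNeg

end Summit.MatrixMultiplication.MatrixMultiplication.Theorems
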